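import Mathlib
import Summits.Ventures.HodgeRepro.Tier4.Target
import Summits.Ventures.HodgeRepro.Tier4.Line3.Defs
import Summits.Ventures.HodgeRepro.Tier4.Line3.DefsLemmas
import Summits.Ventures.HodgeRepro.Tier4.Line3.KMDatumS
import Summits.Ventures.HodgeRepro.Tier4.Line3.MajorantLemmas
import Summits.Ventures.HodgeRepro.Tier4.Line3.Witness.ThetaDataWitnessCf
import Summits.Ventures.HodgeRepro.Tier4.Line3.Witness.MajCoercive
import Summits.Ventures.HodgeRepro.Tier4.Line3.Witness.PhiDel
import Summits.Ventures.HodgeRepro.Tier4.Line3.Witness.LatticeGauss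
import Summits.Ventures.HodgeRepro.Tier4.Line3.Witness.SummandBound

/-!
# Tier4/Line3/Witness/ThetaDataWitnessSummable — the `summable` clause of the R4 witness of LINE L3's `ThetaData`
(seat t4-L2-p2, gen 0, on t4-plan-3's word S12460 (i); blind re-derivation cell `pub-hodge-repro`, Tier 4, README §9–§10)

`cfW_summable`: for EVERY Kudla–Millson datum `Φ : KMDatumS`, every slot `j`, every compact `K ⊆ 𝔹` and every `k`,
the summands `cfW j (x_o) · Φ(y(x_o), z)_k` of the theta series of the cf-side witness (`Witness/ThetaDataWitnessCf.lean`)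
have a majorant `g : Line → ℝ`, summable, uniform in `z ∈ K` — the clause `ThetaData.summable` for `cf := cfW`.

The uniform bound `‖cfW j x · Φ(y(x), z)_k‖ ≤ K₀ ∏_i exp (−c Σ_{σ ≠ τ̄₀} ‖σ x_i‖²)` on `K` is `summand_le` of
`Witness/SummandBound.lean`.  THE SUM: the embeddings `σ ≠ τ̄₀` meet every conjugate pair (`allSet_meets`), so the
Gaussian is summable over `𝓞_{E′}` (`Witness/LatticeGauss.lean`), over `𝓞³ = Lstd` (`summable_pi_prod`, the injection
`toInt`), and over the lines: a line with `cfW ≠ 0` has a norm-one multiple of its representative in `Lstd` (`cfW`'s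
condition), the map line ↦ that lattice point is injective (two such points on the same line differ by a norm-one
scalar), and both factors of the summand are invariant under the norm-one scalars (`cfW_weight`,
`datumS_ballCoord_smul`), so the majorant pulled back to the lines (zero elsewhere) is summable.

Mathlib + the line's definitions + the landed support modules; no printed input.  Nothing here says anything about the
status of the Hodge conjecture for CM abelian varieties, which is NOT proved (HC_CM is NOT proved by anyone in this
repository).
-/

set_option autoImplicit false

noncomputable section

namespace Summit.Ventures.HodgeRepro.Tier4.Line3

open Summit.Ventures.HodgeRepro.Tier4
open Matrix NumberField
open scoped ComplexConjugate ComplexOrder Classical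

namespace T4Data

variable (X : T4Data)

/-! ### Summability over the lattice and over the lines -/

/-- The coordinates of a point of `Lstd` as integers. -/
def toInt (x : X.Lstd) : Fin 3 → 𝓞 X.E := fun i => ⟨x.1 i, (X.mem_Lstd_iff x.1).mp x.2 i⟩

/-- `toInt` is injective. -/
theorem toInt_injective : Function.Injective X.toInt := by
  intro x y hxy
  apply Subtype.ext
  funext i
  have := congrArg (fun v => (algebraMap (𝓞 X.E) X.E (v i))) hxy
  exact this

/-- The Gaussian majorant `K₀ ∏_i exp (−c Σ_{σ ∈ allSet} ‖σ x_i‖²)` is summable over `Lstd`. -/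
theorem summable_gaussMaj (K₀ c : ℝ) (hc : 0 < c) :
    Summable fun x : X.Lstd => K₀ * ∏ i, Real.exp (-(c * ∑ σ ∈ X.allSet, ‖σ (x.1 i)‖ ^ 2)) := by
  have hG := summable_exp_neg_sum_sq X.E X.allSet X.allSet_meets hc
  have hpi := IntegrableMajorant.summable_pi_prod (fun _ : Fin 3 => fun a : 𝓞 X.E =>
    Real.exp (-(c * ∑ σ ∈ X.allSet, ‖σ (algebraMap (𝓞 X.E) X.E a)‖ ^ 2))) (fun _ => hG)
    (fun _ _ => (Real.exp_pos _).le)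
  have := (hpi.mul_left K₀).comp_injective X.toInt_injective
  exact this

/-- **`summable`: the witness has a summable majorant on every compact of the ball.** -/
theorem cfW_summable (Φ : KMDatumS) (j : Fin 4) (K : Set (Fin 2 → ℂ)) (hK : IsCompact K) (hKb : K ⊆ ball)
    (k : Fin 2) :
    ∃ g : X.Line → ℝ, Summable g ∧ ∀ z ∈ K, ∀ o : X.Line,
      ‖X.cfW j (Quot.out o) * datumS Φ (X.ballCoord (Quot.out o)) z k‖ ≤ g o := by
  rcases K.eq_empty_or_nonempty with hKe | hKne
  · exact ⟨0, summable_zero, fun z hz => by simp [hKe] at hz⟩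
  -- the entry bound on `K`
  choose C hC using fun i j : Fin 3 => hK.exists_bound_of_continuousOn ((Φ.cont k i j).mono hKb)
  set CA : ℝ := ∑ i, ∑ j, max 0 (C i j) with hCA
  have hCA0 : 0 ≤ CA := Finset.sum_nonneg fun _ _ => Finset.sum_nonneg fun _ _ => le_max_left _ _
  have hA : ∀ z ∈ K, ∀ i j, ‖Φ.A z k i j‖ ≤ CA := fun z hz i j => by
    refine (hC i j z hz).trans ((le_max_right 0 (C i j)).trans ?_)
    rw [hCA]
    calc max 0 (C i j) ≤ ∑ j', max 0 (C i j') :=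
          Finset.single_le_sum (fun _ _ => le_max_left _ _) (Finset.mem_univ j)
      _ ≤ ∑ i', ∑ j', max 0 (C i' j') :=
          Finset.single_le_sum (fun _ _ => Finset.sum_nonneg fun _ _ => le_max_left _ _) (Finset.mem_univ i)
  -- the majorant constant on `K`
  obtain ⟨z₀, hz₀K, hz₀max⟩ := hK.exists_isMaxOn hKne continuous_nsq.continuousOn
  set κ : ℝ := (1 - nsq z₀) / 4 with hκdef
  have hκ : 0 < κ := by
    have := one_sub_nsq_pos (hKb hz₀K)
    rw [hκdef]; positivity
  have hmaj : ∀ z ∈ K, ∀ y : Fin 3 → ℂ, κ * ∑ i, ‖y i‖ ^ 2 ≤ maj y z := fun z hz y => by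
    refine le_trans ?_ (maj_ge y z (hKb hz))
    have h1 : nsq z ≤ nsq z₀ := hz₀max hz
    have h2 : κ ≤ (1 - nsq z) / 4 := by rw [hκdef]; linarith
    exact mul_le_mul_of_nonneg_right h2 (Finset.sum_nonneg fun _ _ => sq_nonneg _)
  -- the majorant on vectors
  set K₀ : ℝ := 3 * CA * (2 / (Real.pi * κ)) with hK₀
  set c : ℝ := X.cW κ with hc
  have hcpos : 0 < c := X.cW_pos hκ
  let F : (Fin 3 → X.E) → ℝ := fun x => K₀ * ∏ i, Real.exp (-(c * ∑ σ ∈ X.allSet, ‖σ (x i)‖ ^ 2))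
  have hF : ∀ z ∈ K, ∀ x, ‖X.cfW j x * datumS Φ (X.ballCoord x) z k‖ ≤ F x := by
    intro z hz x
    have h := X.summand_le Φ k hCA0 hκ (hA z hz) (hmaj z hz) j x
    have hrew : Real.exp (-(X.cW κ * ∑ σ ∈ X.allSet, ∑ i, ‖σ (x i)‖ ^ 2)) =
        ∏ i, Real.exp (-(c * ∑ σ ∈ X.allSet, ‖σ (x i)‖ ^ 2)) := by
      rw [← Real.exp_sum, Finset.sum_comm, Finset.mul_sum, Finset.sum_neg_distrib]
    rw [hrew] at h
    exact h
  -- the choice of a lattice representative on each line meeting `Lstd`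
  let P : X.Line → Prop := fun o => ∃ t : X.E, X.c t * t = 1 ∧ t • Quot.out o ∈ X.Lstd
  let g : X.Line → ℝ := fun o => if h : P o then F (Classical.choose h • Quot.out o) else 0
  refine ⟨g, ?_, ?_⟩
  · let φ : {o : X.Line // P o} → X.Lstd := fun o =>
      ⟨Classical.choose o.2 • Quot.out o.1, (Classical.choose_spec o.2).2⟩
    have hφ : Function.Injective φ := by
      intro o o' hoo'
      have h := congrArg Subtype.val hoo'
      simp only [φ] at h
      set t := Classical.choose o.2 with ht
      set t' := Classical.choose o'.2 with ht'
      have ht1 : X.c t * t = 1 := (Classical.choose_spec o.2).1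
      have ht1' : X.c t' * t' = 1 := (Classical.choose_spec o'.2).1
      have ht'0 : t' ≠ 0 := by
        intro h0
        rw [h0, mul_zero] at ht1'
        exact zero_ne_one ht1'
      apply Subtype.ext
      have hstep : X.lineStep (Quot.out o.1) (Quot.out o'.1) := by
        refine ⟨t'⁻¹ * t, ?_, ?_⟩
        · have hct' : X.c t' ≠ 0 := by
            intro h0; rw [h0, zero_mul] at ht1'; exact zero_ne_one ht1'
          rw [map_mul, map_inv₀]
          calc (X.c t')⁻¹ * X.c t * (t'⁻¹ * t) = (X.c t * t) * (X.c t' * t')⁻¹ := by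
                rw [mul_inv]; ring
            _ = 1 := by rw [ht1, ht1', inv_one, one_mul]
        · rw [mul_smul, h, inv_smul_smul₀ ht'0]
      have e1 : (Quot.mk X.lineStep (Quot.out o.1) : X.Line) = o.1 := Quot.out_eq _
      have e2 : (Quot.mk X.lineStep (Quot.out o'.1) : X.Line) = o'.1 := Quot.out_eq _
      have e3 : (Quot.mk X.lineStep (Quot.out o.1) : X.Line) = Quot.mk X.lineStep (Quot.out o'.1) :=
        Quot.sound hstep
      rw [← e1, ← e2, e3]
    have hS : Summable (fun x : X.Lstd => F x.1) := X.summable_gaussMaj K₀ c hcpos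
    have h1 : Summable ((fun x : X.Lstd => F x.1) ∘ φ) := hS.comp_injective hφ
    have h2 : Summable (g ∘ (Subtype.val : {o : X.Line // o ∈ {o | P o}} → X.Line)) := by
      refine h1.congr fun o => ?_
      simp only [Function.comp, φ, g, dif_pos o.2]
    have h3 := summable_subtype_iff_indicator.mp h2
    refine h3.congr fun o => ?_
    by_cases h : P o
    · rw [Set.indicator_of_mem (show o ∈ {o | P o} from h)]
    · rw [Set.indicator_of_notMem (show o ∉ {o | P o} from h)]
      simp only [g, dif_neg h]
  · intro z hz o
    by_cases h : P o
    · have hspec := Classical.choose_spec h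
      rw [show g o = F (Classical.choose h • Quot.out o) from dif_pos h]
      rw [← X.cfW_weight j _ hspec.1, ← X.datumS_ballCoord_smul Φ hspec.1]
      exact hF z hz _
    · rw [show g o = 0 from dif_neg h]
      have h0 : X.cfW j (Quot.out o) = 0 := by
        unfold cfW
        rw [if_neg h]
      rw [h0, zero_mul, norm_zero]

end T4Data

end Summit.Ventures.HodgeRepro.Tier4.Line3
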